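import Summits.ValiantsHypothesis.ValiantsHypothesis.Theorems.SymPencilPerFourPeeledTwoPencilFrameData
import Summits.ValiantsHypothesis.ValiantsHypothesis.Theorems.SymPencilPerFourPeeledTwoPencilCaseAQ

/-!
# Route `SymPencil` — inner rank of the `2 | 2` row split of `per_4`, PEELED case: two-pencil
# frames for the class «three zero columns» (`--supports` stmt-ValiantsHypothesis-5674
# `SdcSuperquadratic`; (8,8) column, memo `NOTE-p8g15-5674-R2-two-pencil.md` §9.3 shape `e_m`,
# §9.4 R1(iii); rung currency only)

The Case-A class of p6 g16 (`…TwoPencilCaseAParams.hframes_of_caseA_class`) needs three NON-ZERO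
columns.  Here the opposite corner: if the columns `0, 1, 2` of `Ψ` vanish (`Ψ = c e₃ᵀ`, `c`
arbitrary, `Ψ = 0` included), the two-pencil frame package — stated VERBATIM as the body of the
pointwise hypothesis `hframe` of `…TwoPencilFrameless.false_of_peeled_of_frame_at` — exists:
take `a₀ = 𝟙`, `a₁ = (1,2,3,4)`, and the Case-A Hessian pencil with the FREE triple `h = (1,2,3)`,
`τ = 1` (`z₀ = (5,−1,−1,0)`, `z₁ = (3,0,−1,0)`): the incidences hold because `y_i = z_i` has last
coordinate `0` and only the last column of `Ψ` is non-zero; regularity/eigen-data are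
`…TwoPencilCaseA.caseA_data`, `Q ≠ 0` is `…TwoPencilCaseAQ.caseA_Q_ne_zero` (`a₁ ∉ K a₀`), and the
package is assembled by `…TwoPencilFrameData.frameData_of_hess`.  The other single-column classes
follow by `…TwoPencilFramePerm.frame_of_perm` (p6 g16).

Honest framing: one small class of the `(8,8,11)` coverage programme; no cell closes here; the
window `28 ≤ sdc(per₄) ≤ 29` of record, the crux `SdcSuperquadratic` and `VP ≠ VNP` are untouched.
No definitions, no named facts. [folklore]
-/

noncomputable section

-- single-conjunct layout: Sub = Summit, duplicated namespace component intended
set_option linter.dupNamespace false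

namespace Summit.ValiantsHypothesis.ValiantsHypothesis.Theorems.SymPencilPerFourPeeledTwoPencilZeroColumns

open Matrix Finset Module

universe u

variable {K : Type u} [Field K]

/-- **Frames for `Ψ` with columns `0,1,2` zero.** [folklore] -/
theorem frames_of_three_zero_columns [CharZero K] (Ψ : Matrix (Fin 4) (Fin 4) K)
    (hΨ : ∀ k l : Fin 4, l ≠ 3 → Ψ k l = 0) :
    ∃ (a₀ a₁ y₀ y₁ : Fin 4 → K) (P₀₀ P₁₀ P₀₁ P₁₁ W₀ : Matrix (Fin 4) (Fin 4) K)
        (v : Fin 4 → Fin 4 → K) (s : Fin 4 → K) (W : Matrix (Fin 4) (Fin 4) K),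
        a₀ ⬝ᵥ Ψ *ᵥ y₀ = 0 ∧ a₀ ⬝ᵥ Ψ *ᵥ y₁ = 0 ∧ a₁ ⬝ᵥ Ψ *ᵥ y₀ = 0 ∧ a₁ ⬝ᵥ Ψ *ᵥ y₁ = 0 ∧
        (∀ b l, P₀₀ b l = (Matrix.of ![a₀, Pi.single b 1, y₀, Pi.single l 1]).permanent) ∧
        (∀ b l, P₁₀ b l = (Matrix.of ![a₀, Pi.single b 1, y₁, Pi.single l 1]).permanent) ∧
        (∀ b l, P₀₁ b l = (Matrix.of ![a₁, Pi.single b 1, y₀, Pi.single l 1]).permanent) ∧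
        (∀ b l, P₁₁ b l = (Matrix.of ![a₁, Pi.single b 1, y₁, Pi.single l 1]).permanent) ∧
        W₀ * P₀₀ = 1 ∧ (∀ j, P₁₀ *ᵥ v j = s j • P₀₀ *ᵥ v j) ∧ (∀ i j, i ≠ j → s i ≠ s j) ∧
        W * Matrix.of v = 1 ∧ P₁₁ - P₁₀ * W₀ * P₀₁ ≠ 0 := by
  classical
  -- the frame vectors
  let a₀ : Fin 4 → K := fun _ => 1
  let a₁ : Fin 4 → K := ![1, 2, 3, 4]
  have ha : ∀ k, a₀ k ≠ 0 := fun _ => one_ne_zero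
  have hind : ∀ μ : K, a₁ ≠ μ • a₀ := by
    intro μ e
    have e0 := congr_fun e 0
    have e1 := congr_fun e 1
    simp only [a₁, a₀, Pi.smul_apply, smul_eq_mul, mul_one, Matrix.cons_val_zero,
      Matrix.cons_val_one] at e0 e1
    have : (1 : K) = 2 := e0.trans e1.symm
    norm_num at this
  -- the free triple `h = (1,2,3)` and `τ = 1`
  obtain ⟨h, hh⟩ : ∃ h : Fin 4 → K, h = ![1, 2, 3, 0] := ⟨_, rfl⟩
  have h0 : h 0 ≠ 0 := by rw [hh]; simp
  have h1 : h 1 ≠ 0 := by rw [hh]; simp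
  have h2 : h 2 ≠ 0 := by rw [hh]; simp
  have h01 : h 0 ≠ h 1 := by rw [hh]; simp
  have h02 : h 0 ≠ h 2 := by rw [hh]; simp
  have h12 : h 1 ≠ h 2 := by rw [hh]; simp
  have hτ : (1 : K) ≠ 0 := one_ne_zero
  have hτ1 : h 1 + 1 * h 2 ≠ 0 := by rw [hh]; simp; norm_num
  have hτ2 : (h 1 - h 0) + 1 * (h 2 - h 0) ≠ 0 := by rw [hh]; simp; norm_num
  -- the Hessian matrices
  obtain ⟨H₀, hH₀⟩ : ∃ H₀ : Matrix (Fin 4) (Fin 4) K, ∀ b l, H₀ b l = if b = l then 0 else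
      ((![h 1 + 1 * h 2, -h 0, -(1 * h 0), 0] : Fin 4 → K) 0 +
        (![h 1 + 1 * h 2, -h 0, -(1 * h 0), 0] : Fin 4 → K) 1 +
        (![h 1 + 1 * h 2, -h 0, -(1 * h 0), 0] : Fin 4 → K) 2 +
        (![h 1 + 1 * h 2, -h 0, -(1 * h 0), 0] : Fin 4 → K) 3) -
        (![h 1 + 1 * h 2, -h 0, -(1 * h 0), 0] : Fin 4 → K) b -
        (![h 1 + 1 * h 2, -h 0, -(1 * h 0), 0] : Fin 4 → K) l :=
    ⟨Matrix.of fun b l => _, fun b l => rfl⟩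
  obtain ⟨H₁, hH₁⟩ : ∃ H₁ : Matrix (Fin 4) (Fin 4) K, ∀ b l, H₁ b l = if b = l then 0 else
      ((![h 2, 0, -h 0, 0] : Fin 4 → K) 0 + (![h 2, 0, -h 0, 0] : Fin 4 → K) 1 +
        (![h 2, 0, -h 0, 0] : Fin 4 → K) 2 + (![h 2, 0, -h 0, 0] : Fin 4 → K) 3) -
        (![h 2, 0, -h 0, 0] : Fin 4 → K) b - (![h 2, 0, -h 0, 0] : Fin 4 → K) l :=
    ⟨Matrix.of fun b l => _, fun b l => rfl⟩
  obtain ⟨hinv, hvh, hsh, hW⟩ :=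
    SymPencilPerFourPeeledTwoPencilCaseA.caseA_data h 1 h0 h1 h2 h01 h02 h12 hτ hτ1 hτ2
      H₀ H₁ hH₀ hH₁
  have hQ :=
    SymPencilPerFourPeeledTwoPencilCaseAQ.caseA_Q_ne_zero a₀ a₁ ha hind h 1 h0 h01 h02 h12
      hτ hτ1 hτ2 H₀ hH₀
  -- incidences: `Ψ y = 0` whenever `y 3 = 0`
  have hkill : ∀ (a y : Fin 4 → K), y 3 = 0 → a ⬝ᵥ Ψ *ᵥ y = 0 := by
    intro a y hy
    have : Ψ *ᵥ y = 0 := by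
      funext k
      rw [Matrix.mulVec, dotProduct, Fin.sum_univ_four, Pi.zero_apply,
        hΨ k 0 (by decide), hΨ k 1 (by decide), hΨ k 2 (by decide), hy]
      ring
    rw [this, dotProduct_zero]
  have hz₀ : (fun k => a₀ k * (![h 1 + 1 * h 2, -h 0, -(1 * h 0), 0] : Fin 4 → K) k) 3 = 0 := by
    simp
  have hz₁ : (fun k => a₀ k * (![h 2, 0, -h 0, 0] : Fin 4 → K) k) 3 = 0 := by simp
  exact SymPencilPerFourPeeledTwoPencilFrameData.frameData_of_hess Ψ a₀ a₁ _ _ ha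
    (hkill _ _ hz₀) (hkill _ _ hz₁) (hkill _ _ hz₀) (hkill _ _ hz₁)
    H₀ H₁ hH₀ hH₁ H₀⁻¹ hinv _ _ hvh hsh _ hW hQ

end Summit.ValiantsHypothesis.ValiantsHypothesis.Theorems.SymPencilPerFourPeeledTwoPencilZeroColumns

end
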